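import Summits.Schanuel.Schanuel.Theorems.RootDecomp1KRelLiouvilleCell05

/-!
# RootDecomp1KRelLiouvilleCell — lens 1, generation 34 «RELATIVE-LIOUVILLE CELL of 33364» (RootDecomp1KRelLiouvilleCell.lean fc1db392…, 1985 l) — continuation (RootDecomp1KRelLiouvilleCell06): §7 first half — the shared-digit machinery: `digitSum`, `digit_lower_bound`, the tower indicator `tInd`, `ellT_eq_tsum_tInd`, `form_eq_digitSum`, `exists_digit_ne_zero`

(lens-1 g34 `RootDecomp1KRelLiouvilleCell.lean`, sha256 fc1db392…9176, own farm rc 0 · 0 sorry · axioms std; critic VERDICT STATUS L1658 PORT GO LOW;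
port by census-1 gen 15 in eight parts `RootDecomp1KRelLiouvilleCell01`–`08` — see the PORT NOTE of part 01; `--supports stmt-Schanuel-33364`; rung 0.)
-/

noncomputable section

open Complex IntermediateField Polynomial
open Summit.Schanuel.Schanuel.Theorems.RootDecomp1KHyper
open Summit.Schanuel.Schanuel.Theorems.RootDecomp1KHyper.HyperCell
open Summit.Schanuel.Schanuel.Theorems.RootDecomp1KGeneric

namespace Summit.Schanuel.Schanuel.Theorems.RootDecomp1KRelLiouvilleCell

/-! ## §7  The shared-digit certificate: no hyper-small integer linear form in `(1, ℓ₂, ℓ_T)`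

`ℓ₂ = Σ_k 2^{-k!}` and `ℓ_T = Σ_k 1_T(k) 2^{-k!}` share the digit skeleton `{2^{-k!}}`; an integer form
`h₀ + h₁ℓ₂ + h₂ℓ_T = h₀ + Σ_k u_k 2^{-k!}` has digits `u_k = h₁ + h₂ 1_T(k)`, `|u_k| ≤ S = |h₁| + |h₂|`,
and a NON-ZERO digit at some position `P ≤ 2^{n₀} + 2` past the first scale `n₀` with `2^{n₀ n₀!} ≥ 8S`;
the digit lemma then bounds the form below by `2^{-P!-1} ≥ exp(-(1+S)^{11})`. -/

section Digits
open LiouvilleNumber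
open scoped Nat

/-- The digit series `D(u) = Σ_k u_k 2^{-k!}`. -/
def digitSum (u : ℕ → ℤ) : ℝ := ∑' k, (u k : ℝ) / (2 : ℝ) ^ k !

/-- The series `Σ_k 2^{-k!}` is summable. -/
private theorem summable_one_div_two_pow_factorial : Summable fun k : ℕ => 1 / (2 : ℝ) ^ k ! :=
  summable_one_div_pow_of_le one_lt_two fun k => Nat.self_le_factorial k

/-- A digit series `Σ_k u_k / 2^{k!}` with bounded integer digits is summable. -/
private theorem summable_digit {u : ℕ → ℤ} {S : ℤ} (hS : ∀ k, |u k| ≤ S) :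
    Summable fun k => (u k : ℝ) / (2 : ℝ) ^ k ! := by
  refine Summable.of_norm_bounded (summable_one_div_two_pow_factorial.mul_left (S : ℝ)) fun k => ?_
  have h2 : (0 : ℝ) < 2 ^ k ! := by positivity
  rw [Real.norm_eq_abs, abs_div, abs_of_pos h2, div_eq_mul_one_div]
  exact mul_le_mul_of_nonneg_right (by exact_mod_cast hS k) (one_div_nonneg.mpr h2.le)

/-- **Digit lemma.** Digits bounded by `S`, a NON-ZERO digit at position `n + 1`, and the scale gap
`8 S ≤ 2^{n·n!}`: then `|h₀ + D(u)| ≥ 2^{-(n+1)!-1}` for every integer `h₀`. -/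
theorem digit_lower_bound {u : ℕ → ℤ} {S : ℤ} (hS : ∀ k, |u k| ≤ S) {n : ℕ} (hn : 1 ≤ n)
    (hgap : 8 * S ≤ 2 ^ (n * n !)) (hu : u (n + 1) ≠ 0) (h₀ : ℤ) :
    1 / (2 : ℝ) ^ ((n + 1)! + 1) ≤ |(h₀ : ℝ) + digitSum u| := by
  have hsum := summable_digit hS
  set f : ℕ → ℝ := fun k => (u k : ℝ) / (2 : ℝ) ^ k ! with hf
  have hsplit : digitSum u = ∑ k ∈ Finset.range (n + 2), f k + ∑' k, f (k + (n + 2)) :=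
    (hsum.sum_add_tsum_nat_add (n + 2)).symm
  -- the head is a fraction with denominator `2^{n!}`
  have hhead : ∃ A : ℤ, (h₀ : ℝ) + ∑ k ∈ Finset.range (n + 1), f k = (A : ℝ) / (2 : ℝ) ^ n ! := by
    refine ⟨h₀ * 2 ^ n ! + ∑ k ∈ Finset.range (n + 1), u k * 2 ^ ((n)! - (k)!), ?_⟩
    push_cast
    rw [add_div, mul_div_cancel_right₀ _ (by positivity), Finset.sum_div]
    congr 1
    refine Finset.sum_congr rfl fun k hk => ?_
    have hk' : k ! ≤ n ! := Nat.factorial_le (by have := Finset.mem_range.mp hk; omega)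
    simp only [hf]
    rw [pow_sub₀ _ (by norm_num : (2 : ℝ) ≠ 0) hk']
    field_simp
  obtain ⟨A, hA⟩ := hhead
  have hSnn : (0 : ℤ) ≤ S := (abs_nonneg _).trans (hS 0)
  have h1S : (1 : ℤ) ≤ S := (Int.one_le_abs hu).trans (hS _)
  have hS1 : (1 : ℝ) ≤ S := by exact_mod_cast h1S
  have hS0' : (S : ℝ) ≠ 0 := by positivity
  have hgapR : (8 : ℝ) * S ≤ (2 : ℝ) ^ (n * n !) := by exact_mod_cast hgap
  -- the tail is small: `|Σ_{k ≥ n+2} u_k 2^{-k!}| ≤ 2 S 2^{-(n+2)!}`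
  have hg : Summable fun k : ℕ => (S : ℝ) * (((1 : ℝ) / 2) ^ k * (1 / (2 : ℝ) ^ (n + 2)!)) :=
    (summable_geometric_two.mul_right _).mul_left _
  have hle : ∀ k, |f (k + (n + 2))| ≤ (S : ℝ) * (((1 : ℝ) / 2) ^ k * (1 / (2 : ℝ) ^ (n + 2)!)) := by
    intro k
    simp only [hf]
    rw [abs_div, abs_of_pos (by positivity : (0 : ℝ) < 2 ^ (k + (n + 2))!)]
    have hfac : (n + 2)! + k ≤ (k + (n + 2))! := by
      have := Nat.add_factorial_le_factorial_add k (n := n + 2) (by omega)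
      omega
    have e1 : ((1 : ℝ) / 2) ^ k * (1 / (2 : ℝ) ^ (n + 2)!) = 1 / (2 : ℝ) ^ ((n + 2)! + k) := by
      rw [one_div_pow, pow_add, one_div_mul_one_div, mul_comm]
    rw [e1, div_eq_mul_one_div]
    exact mul_le_mul (by exact_mod_cast hS _) (one_div_pow_le_one_div_pow_of_le (by norm_num) hfac)
      (by positivity) (by exact_mod_cast hSnn)
  have habs : Summable fun k => |f (k + (n + 2))| :=
    Summable.of_nonneg_of_le (fun _ => abs_nonneg _) hle hg
  have htail : |∑' k, f (k + (n + 2))| ≤ 2 * S / (2 : ℝ) ^ (n + 2)! := by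
    calc |∑' k, f (k + (n + 2))| ≤ ∑' k, |f (k + (n + 2))| := by
          have := norm_tsum_le_tsum_norm (f := fun k => f (k + (n + 2)))
            (by simpa only [Real.norm_eq_abs] using habs)
          simpa only [Real.norm_eq_abs] using this
      _ ≤ ∑' k : ℕ, (S : ℝ) * (((1 : ℝ) / 2) ^ k * (1 / (2 : ℝ) ^ (n + 2)!)) :=
          Summable.tsum_le_tsum hle habs hg
      _ = S * (2 * (1 / (2 : ℝ) ^ (n + 2)!)) := by
          rw [tsum_mul_left, tsum_mul_right, tsum_geometric_two]
      _ = 2 * S / (2 : ℝ) ^ (n + 2)! := by ring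
  -- the powers of two
  have e1 : (2 : ℝ) ^ (n + 1)! = 2 ^ n ! * 2 ^ (n * n !) := by
    rw [← pow_add, Nat.factorial_succ]; congr 1; ring
  have e2 : (2 : ℝ) ^ (n + 1)! * 2 ^ (n * n !) ≤ 2 ^ (n + 2)! := by
    rw [← pow_add]
    refine pow_le_pow_right₀ (by norm_num) ?_
    have h1 : (n + 2)! = (n + 2) * (n + 1)! := Nat.factorial_succ (n + 1)
    have h2 : n * n ! ≤ (n + 1) * (n + 1)! := Nat.mul_le_mul (by omega) (Nat.factorial_le (by omega))
    rw [h1]; nlinarith [h2]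
  have hX : (0 : ℝ) < 2 ^ (n + 1)! := by positivity
  -- the leading part
  have hcS : |(u (n + 1) : ℝ)| ≤ S := by exact_mod_cast hS (n + 1)
  have hc1 : (1 : ℝ) ≤ |(u (n + 1) : ℝ)| := by exact_mod_cast Int.one_le_abs hu
  have hmain : 1 / (2 : ℝ) ^ (n + 1)! ≤ |(A : ℝ) / 2 ^ n ! + (u (n + 1) : ℝ) / 2 ^ (n + 1)!| := by
    by_cases hA0 : A = 0
    · rw [hA0, Int.cast_zero, zero_div, zero_add, abs_div, abs_of_pos hX]
      exact div_le_div_of_nonneg_right hc1 hX.le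
    · have hA1 : (1 : ℝ) ≤ |(A : ℝ)| := by exact_mod_cast Int.one_le_abs hA0
      have eA : (A : ℝ) / 2 ^ n ! = (A * 2 ^ (n * n !)) / 2 ^ (n + 1)! := by
        rw [e1]; field_simp
      rw [eA, ← add_div, abs_div, abs_of_pos hX]
      refine div_le_div_of_nonneg_right ?_ hX.le
      have h1 : (8 : ℝ) * S ≤ |(A : ℝ) * 2 ^ (n * n !)| := by
        rw [abs_mul, abs_of_pos (by positivity : (0 : ℝ) < 2 ^ (n * n !))]
        nlinarith [hgapR, hA1]
      have h2 : |(A : ℝ) * 2 ^ (n * n !)| ≤ |(A : ℝ) * 2 ^ (n * n !) + u (n + 1)| + |(u (n + 1) : ℝ)| := by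
        have := abs_add_le ((A : ℝ) * 2 ^ (n * n !) + u (n + 1)) (-(u (n + 1) : ℝ))
        simp only [add_neg_cancel_right, abs_neg] at this
        exact this
      linarith
  -- assembling
  have hdecomp : (h₀ : ℝ) + digitSum u =
      ((A : ℝ) / 2 ^ n ! + (u (n + 1) : ℝ) / 2 ^ (n + 1)!) + ∑' k, f (k + (n + 2)) := by
    rw [hsplit, Finset.sum_range_succ, ← add_assoc, ← add_assoc, hA]
  rw [hdecomp]
  have htri : |(A : ℝ) / 2 ^ n ! + (u (n + 1) : ℝ) / 2 ^ (n + 1)!| - |∑' k, f (k + (n + 2))| ≤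
      |((A : ℝ) / 2 ^ n ! + (u (n + 1) : ℝ) / 2 ^ (n + 1)!) + ∑' k, f (k + (n + 2))| := by
    have := abs_add_le (((A : ℝ) / 2 ^ n ! + (u (n + 1) : ℝ) / 2 ^ (n + 1)!) +
      ∑' k, f (k + (n + 2))) (-(∑' k, f (k + (n + 2))))
    simp only [add_neg_cancel_right, abs_neg] at this
    linarith
  have htail' : |∑' k, f (k + (n + 2))| ≤ (1 / 4) * (1 / (2 : ℝ) ^ (n + 1)!) := by
    refine htail.trans ?_
    have hpos1 : (0 : ℝ) < 2 ^ (n + 1)! * 2 ^ (n * n !) := by positivity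
    have hpos2 : (0 : ℝ) < 2 ^ (n + 1)! * (8 * S) := mul_pos hX (by linarith)
    calc (2 : ℝ) * S / 2 ^ (n + 2)! ≤ 2 * S / (2 ^ (n + 1)! * 2 ^ (n * n !)) :=
          div_le_div_of_nonneg_left (by positivity) hpos1 e2
      _ ≤ 2 * S / (2 ^ (n + 1)! * (8 * S)) :=
          div_le_div_of_nonneg_left (by positivity) hpos2 (mul_le_mul_of_nonneg_left hgapR hX.le)
      _ = (1 / 4) * (1 / (2 : ℝ) ^ (n + 1)!) := by field_simp; ring
  have e3 : 1 / (2 : ℝ) ^ ((n + 1)! + 1) = (1 / 2) * (1 / (2 : ℝ) ^ (n + 1)!) := by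
    rw [pow_succ]; ring
  rw [e3]
  have hXnn : (0 : ℝ) ≤ 1 / (2 : ℝ) ^ (n + 1)! := by positivity
  linarith [hmain, htri, htail']

open Classical in
/-- The digit indicator `1_T` of the tower `T = {t_j}`. -/
noncomputable def tInd (k : ℕ) : ℤ := if k ∈ Set.range tIdx then 1 else 0

/-- The tower indicator is `1` on the tower: `tInd (t_j) = 1`. -/
theorem tInd_tIdx (j : ℕ) : tInd (tIdx j) = 1 := by
  unfold tInd; exact if_pos ⟨j, rfl⟩

/-- The tower indicator vanishes off the tower. -/
theorem tInd_of_not_mem {k : ℕ} (hk : k ∉ Set.range tIdx) : tInd k = 0 := by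
  unfold tInd; exact if_neg hk

/-- Case split: `k` is on the tower (`tInd k = 1`) or off it (`tInd k = 0`). -/
theorem tInd_cases (k : ℕ) :
    (k ∈ Set.range tIdx ∧ tInd k = 1) ∨ (k ∉ Set.range tIdx ∧ tInd k = 0) := by
  by_cases hk : k ∈ Set.range tIdx
  · exact Or.inl ⟨hk, by unfold tInd; exact if_pos hk⟩
  · exact Or.inr ⟨hk, tInd_of_not_mem hk⟩

/-- `|tInd k| ≤ 1`. -/
theorem abs_tInd_le (k : ℕ) : |tInd k| ≤ 1 := by
  rcases tInd_cases k with ⟨-, h⟩ | ⟨-, h⟩ <;> simp [h]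

/-- `ℓ_T` as a digit series on the skeleton `{2^{-k!}}`. -/
theorem ellT_eq_tsum_tInd : ellT = ∑' k, (tInd k : ℝ) / (2 : ℝ) ^ k ! := by
  have hsupp : Function.support (fun k => (tInd k : ℝ) / (2 : ℝ) ^ k !) ⊆ Set.range tIdx := by
    intro k hk
    by_contra hk'
    exact hk (by simp [tInd_of_not_mem hk'])
  rw [ellT, ← tIdx_strictMono.injective.tsum_eq hsupp]
  exact tsum_congr fun j => by simp [tInd_tIdx]

/-- The integer linear form `h₀ + h₁ℓ₂ + h₂ℓ_T` is `h₀ + D(u)` with digits `u_k = h₁ + h₂·1_T(k)`. -/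
theorem form_eq_digitSum (h₀ h₁ h₂ : ℤ) :
    (h₀ : ℝ) + h₁ * liouvilleNumber 2 + h₂ * ellT = h₀ + digitSum fun k => h₁ + h₂ * tInd k := by
  have hs1 := summable_one_div_two_pow_factorial
  have hs2 : Summable fun k : ℕ => (tInd k : ℝ) / (2 : ℝ) ^ k ! := summable_digit abs_tInd_le
  rw [add_assoc, digitSum, liouvilleNumber, ellT_eq_tsum_tInd, ← tsum_mul_left, ← tsum_mul_left,
    ← (hs1.mul_left _).tsum_add (hs2.mul_left _)]
  congr 1
  exact tsum_congr fun k => by push_cast; ring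

/-- Among `N + 1, N + 2` at least one is NOT in the tower. -/
theorem exists_not_mem_tower (N : ℕ) : (N + 1) ∉ Set.range tIdx ∨ (N + 2) ∉ Set.range tIdx := by
  by_cases h1 : (N + 1) ∈ Set.range tIdx
  · right
    rintro ⟨j, hj⟩
    obtain ⟨i, hi⟩ := h1
    exact tIdx_ne_tIdx_add_one i j (by omega)
  · exact Or.inl h1

/-- The first tower element above `N ≥ 1` is at most `2^N`. -/
theorem exists_tower_mem_le {N : ℕ} (hN : 1 ≤ N) : ∃ j, N + 1 ≤ tIdx j ∧ tIdx j ≤ 2 ^ N := by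
  classical
  have hex : ∃ j, N + 1 ≤ tIdx j := ⟨N, by have := le_tIdx N; omega⟩
  refine ⟨Nat.find hex, Nat.find_spec hex, ?_⟩
  rcases Nat.eq_zero_or_pos (Nat.find hex) with h0 | hpos
  · rw [h0, tIdx_zero]
    calc 2 = 2 ^ 1 := by norm_num
      _ ≤ 2 ^ N := Nat.pow_le_pow_right (by norm_num) hN
  · obtain ⟨j, hj⟩ : ∃ j, Nat.find hex = j + 1 := ⟨Nat.find hex - 1, by omega⟩
    have hmin : ¬ (N + 1 ≤ tIdx j) := Nat.find_min hex (by omega)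
    rw [hj, tIdx_succ]
    exact Nat.pow_le_pow_right (by norm_num) (by omega)

/-- A non-zero digit of `u_k = h₁ + h₂ 1_T(k)` at a controlled position past `N`. -/
theorem exists_digit_ne_zero (h₁ h₂ : ℤ) (h12 : h₁ ≠ 0 ∨ h₂ ≠ 0) {N : ℕ} (hN : 1 ≤ N) :
    ∃ P, N + 1 ≤ P ∧ P ≤ 2 ^ N + 2 ∧ h₁ + h₂ * tInd P ≠ 0 := by
  have hN2 : N < 2 ^ N := Nat.lt_two_pow_self
  by_cases e1 : h₁ = 0
  · have e2 : h₂ ≠ 0 := h12.elim (fun h => absurd e1 h) id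
    obtain ⟨j, hj1, hj2⟩ := exists_tower_mem_le hN
    refine ⟨tIdx j, hj1, by omega, ?_⟩
    rw [e1, tInd_tIdx]; simpa using e2
  · by_cases e12 : h₁ + h₂ = 0
    · rcases exists_not_mem_tower N with hP | hP
      · exact ⟨N + 1, le_rfl, by omega, by rw [tInd_of_not_mem hP]; simpa using e1⟩
      · exact ⟨N + 2, by omega, by omega, by rw [tInd_of_not_mem hP]; simpa using e1⟩
    · refine ⟨N + 1, le_rfl, by omega, ?_⟩
      rcases tInd_cases (N + 1) with ⟨-, e⟩ | ⟨-, e⟩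
      · rw [e]; simpa using e12
      · rw [e]; simpa using e1

end Digits

end Summit.Schanuel.Schanuel.Theorems.RootDecomp1KRelLiouvilleCell
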